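import Summits.QuantumFields.BalabanUV.T4Continuum.Support.SliceFlatGradient

/-!
# G-an2-4 ∕ (CONV-C), INTERFACE REQUEST (B5-1115-TABLE), item (E4), step 1: [B5] (1.110) FOURTH ENTRY «ΔG» AT `U = 1` IN KERNEL
# FORM ON THE NE3 CARRIER — cube sums of the unit vector-Laplacian applied to the flat propagator, `Σ_{q ∈ Δ_j(y₁)} |(E·G_j)(p,q)|`,
# exponentially localised and O(1), uniform in the spacing

G-an2-4 formalisation swarm `b2b-balaban-gan24-formalise-*`, leaf prover 04 (gen 46), crux team (2) under the coordinator ruling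
«YM REDIRECT» (e34b3e0c); toward the road-P2 crux prover's **INTERFACE REQUEST G-an2-4: (B5-1115-TABLE)** item **(E4)**
`B5Prop12Entries110.Entry110Lap` («|(ΔGJ)(x)| ≤ C·e^{−δ|y−y′|}|J|», `Δ = B5Prop11Lower.Lap n M`).  On the NE3 carrier the kernel of
`Δ·G` is `stencilE·gFlat j` EXACTLY (the two factors `n²` of `Lap = n²·stencil` and `gFlat = n²·Re G` cancel against
`SliceFlatStencil.scaled_LapR_eq_stencil`; step 2 does the dictionary).  THIS FILE bounds its cube sums with NE3's own inputs:
 * §1 THE IDENTITY `stencilE·gFlat j = 1 − flatNg j·gFlat j − massKernel_j·gFlat j` (`kFlat j = stencilE + flatNg j + massKernel_j` by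
   the definition of `flatNg` and `flatE_eq_stencil`; `kFlat·gFlat = 1`);
 * §2 END **`cubeSum_stencilE_mul_gFlat_le`**: `∃ B₄ δ > 0` (functions of `d`) with, for all `k N L`, `j ≤ k`, `p`, `y₁`:
   `Σ_{q : cubeI j q = y₁} |(stencilE·gFlat j)(p,q)| ≤ B₄·e^{−δ·nbd_j(cubeI j p, y₁)}` — NO factor `L^j`: the weighted rows of `flatNg j` and
   of the mass kernel are `O((L^j)^{−2})` (NE3's `cubeRow_flatNg_le` with the (3.49) entry bound `flatNg_le_349`, `cubeRow_massKernel_le`,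
   CUBE-LOCALISED ⇒ WEIGHTED `weightedRow_of_cubeRows`), those of `gFlat j` are `O((L^j)²)` (`weightedRow_gFlat`), weighted rows are
   submultiplicative (`weightedRow_mul_le`), and WEIGHTED ⇒ CUBE-LOCALISED (`cubeSum_le_of_weightedRow`).
Step 2 (file `GAN24/Entry110LapCubic`): transport to pv15's carrier and the (1.110) sup entry on cubic tori.

HONEST SCOPE.  `U = 1`, `a = 1`; CUBIC tori (the NE3 carrier has one period); constants NE3's; nothing printed is asserted — [B5]
`Balaban1984PropagatorsI` p. 35 (1.110) is a TEXT LOCATION; the analysis ((3.49) entry bound, (G) weighted rows) is t4-ne3-p1's (gens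
13–15), used BY NAME; this file adds one algebraic identity.  No `def`, no `def … : Prop`, no `sorry`.  NOT (CONV-C), NEVER «G-an2-4
closed», NOT NE2 ∕ NE3, NOT D1, NOT BetaPertH, NOT continuum, NOT Clay; not in print — our bookkeeping.  ABSOLUTE RULE of the cell kept.
HONEST DEPENDENCY: continuum YM on T⁴ ⇐ BetaPertH ∧ nine spine estimates (0/9 proved); BetaPertH ⇐ (D1) ∧ (D4) ∧ CAP+tail; G-an2-4
gates asym, D1 and NE2/3/4.
-/

noncomputable section

open Real Finset Matrix

namespace Summit.QuantumFields.BalabanUV.Beta.GAN24.Entry110LapFlat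

open Literature.MathematicalPhysics.QuantumFieldTheory.Balaban1983to89
open Literature.MathematicalPhysics.QuantumFieldTheory.Balaban1983to89.TreeLengthTorus (TPt)
open Literature.MathematicalPhysics.QuantumFieldTheory.Balaban1983to89.T4SliceOperatorData (massKernel countConst countConst_pos)
open Summit.QuantumFields.BalabanUV.T4Continuum
open SliceTorusBlocks SliceTorusTower SliceCovariantModel SliceCovariantTower SliceTorusComb SliceFlatPropagator SliceFlatOperators
open SliceFlatStencil SliceFlatGaugeDecay SliceFlatFreeResolvent SliceFlatGradientPrep SliceFlatGradient

variable (d k N L : ℕ) [NeZero N] [NeZero L]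

/-! ## §1 The unit stencil applied to the flat propagator -/

/-- `kFlat j = stencilE + flatNg j + massKernel_j` (the definition of the remainder form `flatNg` and `flatE = stencilE`). [folklore] -/
theorem kFlat_eq_stencil_add (j : ℕ) :
    kFlat d k N L j = stencilE d k N L + flatNg d k N L j
      + massKernel (cubeI (d + 1) k N L (Fin (d + 1)) j) (tau (cubeComb (d + 1) k N L j) (flatRm d k N L))
          (flatAm j / ((L : ℝ) ^ j) ^ (d + 1 + 2)) := by
  rw [← flatE_eq_stencil]
  unfold flatNg
  abel

/-- **`stencilE·gFlat j = 1 − flatNg j·gFlat j − massKernel_j·gFlat j`** (`kFlat·gFlat = 1`). [folklore] -/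
theorem stencilE_mul_gFlat_eq (j : ℕ) :
    stencilE d k N L * gFlat d k N L j
      = 1 - flatNg d k N L j * gFlat d k N L j
        - massKernel (cubeI (d + 1) k N L (Fin (d + 1)) j) (tau (cubeComb (d + 1) k N L j) (flatRm d k N L))
            (flatAm j / ((L : ℝ) ^ j) ^ (d + 1 + 2)) * gFlat d k N L j := by
  have h : stencilE d k N L = kFlat d k N L j - flatNg d k N L j
      - massKernel (cubeI (d + 1) k N L (Fin (d + 1)) j) (tau (cubeComb (d + 1) k N L j) (flatRm d k N L))
          (flatAm j / ((L : ℝ) ^ j) ^ (d + 1 + 2)) := by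
    rw [kFlat_eq_stencil_add]; abel
  rw [h, Matrix.sub_mul, Matrix.sub_mul, kFlat_mul_gFlat]

/-! ## §2 END: cube sums of `stencilE·gFlat j`, O(1) and exponentially localised -/

/-- **[B5] (1.110) FOURTH ENTRY `ΔG` AT `U = 1` IN KERNEL FORM ON THE NE3 CARRIER**: there are `B₄, δ > 0` (functions of `d`) such that
for all `k N L`, every level `j ≤ k`, every row `p` and every level-`j` block `y₁`,
`Σ_{q : cubeI j q = y₁} |(stencilE·gFlat j)(p,q)| ≤ B₄·e^{−δ·nbd_j(cubeI j p, y₁)}` — O(1), uniformly in the spacing `L^{−j}` and in the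
volume.  (Location of the printed text: [B5] `Balaban1984PropagatorsI` p. 35, (1.110), fourth entry; the typed inequality is not a
quotation.) [folklore] -/
theorem cubeSum_stencilE_mul_gFlat_le :
    ∃ B₄ δ : ℝ, 0 < B₄ ∧ 0 < δ ∧ ∀ (k N L : ℕ) [NeZero N] [NeZero L] (j : ℕ), j ≤ k →
      ∀ (p : TPt (d + 1) (N * L ^ k) × Fin (d + 1)) (y₁ : TPt (d + 1) (levM k N L j)),
        ∑ q ∈ Finset.univ.filter (fun q => cubeI (d + 1) k N L (Fin (d + 1)) j q = y₁),
            |(stencilE d k N L * gFlat d k N L j) p q|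
          ≤ B₄ * Real.exp (-(δ * nbd (d + 1) k N L j (cubeI (d + 1) k N L (Fin (d + 1)) j p) y₁)) := by
  obtain ⟨δ₁, C₁, hδ₁, hC₁, h349⟩ := flatNg_le_349 d
  have hf0 := flatδ₀_pos d
  set δ : ℝ := min (flatδ₀ d) (δ₁ / 2) / 2 with hδdef
  have hmin : 0 < min (flatδ₀ d) (δ₁ / 2) := lt_min hf0 (by linarith)
  have hδ : 0 < δ := by rw [hδdef]; linarith
  have hδf : δ < flatδ₀ d := by
    have : min (flatδ₀ d) (δ₁ / 2) ≤ flatδ₀ d := min_le_left _ _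
    rw [hδdef]; linarith
  have hδ1 : δ < δ₁ / 2 := by
    have : min (flatδ₀ d) (δ₁ / 2) ≤ δ₁ / 2 := min_le_right _ _
    rw [hδdef]; linarith
  set KK : ℝ := Real.exp (δ * (d + 1)) * (2 : ℝ) ^ (d + 1) with hKK
  set CG : ℝ := flatB₀ d * KK * countConst (flatδ₀ d - δ) (d + 1) with hCG
  set CN : ℝ := ((d : ℝ) + 1) * C₁ * KK * countConst (δ₁ / 2 - δ) (d + 1) with hCN
  set CM : ℝ := ((d : ℝ) + 1) * KK * countConst 1 (d + 1) with hCM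
  have hKK0 : 0 < KK := by rw [hKK]; positivity
  have hcG := countConst_pos (sub_pos.2 hδf) (d + 1)
  have hc1 := countConst_pos one_pos (d + 1)
  have hcN := countConst_pos (sub_pos.2 hδ1) (d + 1)
  have hCG0 : 0 ≤ CG := by rw [hCG]; exact mul_nonneg (mul_nonneg (flatB₀_nonneg d) hKK0.le) hcG.le
  have hCN0 : 0 ≤ CN := by rw [hCN]; positivity
  have hCM0 : 0 ≤ CM := by rw [hCM]; positivity
  refine ⟨(1 + (CN + CM) * CG) * Real.exp (δ * (d + 1)), δ, by positivity, hδ, fun k N L _ _ j hj p y₁ => ?_⟩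
  have hL : (0 : ℝ) < (L : ℝ) := by exact_mod_cast Nat.pos_of_ne_zero (NeZero.ne L)
  have hLj : (0 : ℝ) < (L : ℝ) ^ j := pow_pos hL j
  obtain ⟨hEpos, hEtri, hEdiag⟩ := wE_facts d k N L j hδ.le
  set MK : Matrix (TPt (d + 1) (N * L ^ k) × Fin (d + 1)) (TPt (d + 1) (N * L ^ k) × Fin (d + 1)) ℝ :=
    massKernel (cubeI (d + 1) k N L (Fin (d + 1)) j) (tau (cubeComb (d + 1) k N L j) (flatRm d k N L))
      (flatAm j / ((L : ℝ) ^ j) ^ (d + 1 + 2)) with hMK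
  have hG : ∀ x, ∑ z, |gFlat d k N L j x z| * wE d k N L j δ x z ≤ CG * ((L : ℝ) ^ j) ^ 2 := fun x =>
    (weightedRow_gFlat d k N L hj hδ.le hδf x).trans (le_of_eq (by rw [hCG, hKK]; ring))
  have hNg : ∀ x, ∑ z, |flatNg d k N L j x z| * wE d k N L j δ x z ≤ CN * (((L : ℝ) ^ j) ^ 2)⁻¹ := by
    intro x
    have h := weightedRow_of_cubeRows d k N L hj (flatNg d k N L j) (δ₀ := δ₁ / 2) hδ.le hδ1 (by positivity) x
      (fun b => cubeRow_flatNg_le d k N L hj hC₁.le (h349 k N L j hj) x b)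
    exact h.trans (le_of_eq (by rw [hCN, hKK]; ring))
  have hM : ∀ x, ∑ z, |MK x z| * wE d k N L j δ x z ≤ CM * (((L : ℝ) ^ j) ^ 2)⁻¹ := by
    intro x
    have h := weightedRow_of_cubeRows d k N L hj MK (δ₀ := δ + 1) hδ.le (by linarith) (by positivity) x
      (fun b => cubeRow_massKernel_le d k N L hj (δ + 1) x b)
    rw [show δ + 1 - δ = 1 by ring] at h
    exact h.trans (le_of_eq (by rw [hCM, hKK]; ring))
  have hNgG : ∀ x, ∑ z, |(flatNg d k N L j * gFlat d k N L j) x z| * wE d k N L j δ x z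
      ≤ (CN * (((L : ℝ) ^ j) ^ 2)⁻¹) * (CG * ((L : ℝ) ^ j) ^ 2) :=
    weightedRow_mul_le _ _ _ (by positivity) (fun x z => (hEpos x z).le) hEtri hNg hG
  have hMG : ∀ x, ∑ z, |(MK * gFlat d k N L j) x z| * wE d k N L j δ x z
      ≤ (CM * (((L : ℝ) ^ j) ^ 2)⁻¹) * (CG * ((L : ℝ) ^ j) ^ 2) :=
    weightedRow_mul_le _ _ _ (by positivity) (fun x z => (hEpos x z).le) hEtri hM hG
  have h1 : ∑ z, |(1 : Matrix (TPt (d + 1) (N * L ^ k) × Fin (d + 1)) (TPt (d + 1) (N * L ^ k) × Fin (d + 1)) ℝ) p z|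
      * wE d k N L j δ p z = 1 := by
    rw [Finset.sum_eq_single p (fun z _ hz => by simp [Ne.symm hz]) (fun h => absurd (Finset.mem_univ p) h)]
    simp [hEdiag p]
  have hrow : ∑ z, |(stencilE d k N L * gFlat d k N L j) p z| * wE d k N L j δ p z ≤ 1 + (CN + CM) * CG := by
    rw [stencilE_mul_gFlat_eq, ← hMK]
    calc ∑ z, |((1 : Matrix (TPt (d + 1) (N * L ^ k) × Fin (d + 1)) (TPt (d + 1) (N * L ^ k) × Fin (d + 1)) ℝ) - flatNg d k N L j * gFlat d k N L j - MK * gFlat d k N L j) p z| * wE d k N L j δ p z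
        ≤ ∑ z, (|(1 : Matrix (TPt (d + 1) (N * L ^ k) × Fin (d + 1)) (TPt (d + 1) (N * L ^ k) × Fin (d + 1)) ℝ) p z|
              * wE d k N L j δ p z
            + |(flatNg d k N L j * gFlat d k N L j) p z| * wE d k N L j δ p z
            + |(MK * gFlat d k N L j) p z| * wE d k N L j δ p z) := by
          refine Finset.sum_le_sum fun z _ => ?_
          rw [Matrix.sub_apply, Matrix.sub_apply, ← add_mul, ← add_mul]
          exact mul_le_mul_of_nonneg_right (by
            calc |(1 : Matrix (TPt (d + 1) (N * L ^ k) × Fin (d + 1)) (TPt (d + 1) (N * L ^ k) × Fin (d + 1)) ℝ) p z - (flatNg d k N L j * gFlat d k N L j) p z - (MK * gFlat d k N L j) p z|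
                ≤ |(1 : Matrix (TPt (d + 1) (N * L ^ k) × Fin (d + 1)) (TPt (d + 1) (N * L ^ k) × Fin (d + 1)) ℝ) p z - (flatNg d k N L j * gFlat d k N L j) p z| + |(MK * gFlat d k N L j) p z| :=
                  abs_sub _ _
              _ ≤ |(1 : Matrix (TPt (d + 1) (N * L ^ k) × Fin (d + 1)) (TPt (d + 1) (N * L ^ k) × Fin (d + 1)) ℝ) p z| + |(flatNg d k N L j * gFlat d k N L j) p z| + |(MK * gFlat d k N L j) p z| :=
                  add_le_add (abs_sub _ _) le_rfl) (hEpos p z).le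
      _ ≤ 1 + (CN * (((L : ℝ) ^ j) ^ 2)⁻¹) * (CG * ((L : ℝ) ^ j) ^ 2) + (CM * (((L : ℝ) ^ j) ^ 2)⁻¹) * (CG * ((L : ℝ) ^ j) ^ 2) := by
          rw [Finset.sum_add_distrib, Finset.sum_add_distrib, h1]
          exact add_le_add (add_le_add le_rfl (hNgG p)) (hMG p)
      _ = 1 + (CN + CM) * CG := by field_simp; ring
  have h := cubeSum_le_of_weightedRow d k N L j (stencilE d k N L * gFlat d k N L j) hδ.le p hrow y₁
  calc _ ≤ _ := h
    _ = _ := by ring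

end Summit.QuantumFields.BalabanUV.Beta.GAN24.Entry110LapFlat

end
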